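import Literature.Analysis.FluidPDE.KNSSTypeIRateMildCompactnessProofs
import HarnessLib

/-!
# Crux `NoTypeIBlowup` (stmt-NavierStokesRegularity-1217), line `head-flux-channel`:
  stub S1a `stub_typeIZoom`, helper 1 — compactness in the Type-I-rate Oseen-mild class

Helper file (theorems only) towards the Type-I zoom `stub_typeIZoom`. It isolates the
compactness step of Koch–Nadirashvili–Seregin–Šverák 2009 (Acta Math. 203 = arXiv:0709.3599,
Lemma 6.1, p. 11, as used in the proof of Theorem 6.2, p. 13) with EXACTLY the hypotheses the
tree's proof of `KNSS2009_typeI_rate_mildCompactness_holds`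
(`Literature/Analysis/FluidPDE/KNSSTypeIRateMildCompactnessProofs.lean`) really uses: classical
solutions `w k` (`ν = 1`) on `ℝ³ × (A k, B k)` with `A k → −∞`, `0 < B k`, satisfying the Oseen
integral equation `w k t = e^{(t−s)Δ} w k s − B¹_s(w k, w k)(t)` between all times of
`(A k, B k)`, and the rate bound `√(−τ)‖w k τ x‖ ≤ C` on `(A k, 0)`. The vendored statement
`KNSS2009_typeI_rate_mildCompactness` carries in addition the doubly-rescaled bookkeeping
(`M k → ∞`, `0 < K`, boundedness on `(A k, 0]`, and the horizontal bound (wkbound2) with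
`cylRadius`), which a general Type-I zoom cannot supply and which the proof carries unused;
`typeIZoom_compactness` below is that proof with those hypotheses deleted.

Conclusion: a subsequence `φ` and a field `W` on `(−∞, 0) × ℝ³`, jointly continuous, with weakly
divergence-free slices, `√(−t)‖W t x‖ ≤ C`, satisfying the Oseen equation between all `s < t < 0`,
with `w (φ k) t → W t` locally uniformly for every `t < 0`.

Lands `--supports stmt-NavierStokesRegularity-1217`.
-/

noncomputable section

namespace Summit.NavierStokesRegularity.NavierStokesRegularity.Theorems

open MeasureTheory Set Filter Topology Function Metric
open scoped RealInnerProductSpace NNReal ENNReal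
open Literature.Analysis Literature.Analysis.FluidPDE

/-- **Compactness in the Type-I-rate Oseen-mild class** (KNSS 2009, Lemma 6.1, arXiv:0709.3599
p. 11, as used in the proof of Theorem 6.2, p. 13; the tree's
`KNSS2009_typeI_rate_mildCompactness_holds` with its unused hypotheses removed). Given classical
solutions `w k` (`ν = 1`, no force) on `ℝ³ × (A k, B k)` with `A k → −∞`, `0 < B k`, satisfying
the Oseen integral equation between all times of `(A k, B k)` and the rate bound
`√(−τ)‖w k τ x‖ ≤ C` for `A k < τ < 0`, a subsequence converges, slice-wise locally uniformly at
every negative time, to a jointly continuous `W` on `(−∞, 0) × ℝ³` with weakly divergence-free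
slices, `√(−t)‖W‖ ≤ C`, satisfying the Oseen integral equation between all `s < t < 0`. Proof:
uniform `1/4`-Hölder bounds for bounded solutions of the Oseen equation on compact slab pieces
(`exists_holder_quarter_of_oseenMild`), a diagonal Arzelà–Ascoli extraction
(`exists_strictMono_tendstoUniformlyOn_of_bound`), and dominated convergence in the
divergence-free condition and in the Oseen equation (`tendsto_heatExtension_of_tendsto_of_bound`,
`tendsto_oseenDuhamel_of_tendsto_of_bound`).
[cite: KochNadirashviliSereginSverak2009, Lemma 6.1 (arXiv p. 11) and proof of Thm 6.2 (p. 13)] -/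
theorem typeIZoom_compactness :
    ∀ (C : ℝ) (A B : ℕ → ℝ) (w : ℕ → ℝ → EuclideanSpace ℝ (Fin 3) → EuclideanSpace ℝ (Fin 3))
      (q : ℕ → ℝ → EuclideanSpace ℝ (Fin 3) → ℝ), 0 < C → Filter.Tendsto A Filter.atTop Filter.atBot →
      (∀ k, 0 < B k) →
      (∀ k, Literature.Analysis.FluidPDE.IsClassicalNSSolutionOn (Set.Ioo (A k) (B k)) 1 0 (w k) (q k)) →
      (∀ k, ∀ s t : ℝ, A k < s → s < t → t < B k → ∀ x,
        w k t x = Literature.Analysis.UnboundedOperators.heatExtension (w k s) (t - s) x -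
          Literature.Analysis.FluidPDE.oseenDuhamel 1 s (w k) (w k) t x) →
      (∀ k, ∀ τ ∈ Set.Ioo (A k) 0, ∀ x, Real.sqrt (-τ) * ‖w k τ x‖ ≤ C) →
      ∃ (φ : ℕ → ℕ) (W : ℝ → EuclideanSpace ℝ (Fin 3) → EuclideanSpace ℝ (Fin 3)), StrictMono φ ∧
        ContinuousOn (Function.uncurry W) (Set.Iio 0 ×ˢ Set.univ) ∧
        (∀ t < 0, Literature.Analysis.FluidPDE.IsWeaklyDivFree (W t)) ∧
        (∀ t < 0, ∀ x, Real.sqrt (-t) * ‖W t x‖ ≤ C) ∧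
        (∀ s t : ℝ, s < t → t < 0 → ∀ x,
          W t x = Literature.Analysis.UnboundedOperators.heatExtension (W s) (t - s) x -
            Literature.Analysis.FluidPDE.oseenDuhamel 1 s W W t x) ∧
        (∀ t < 0, TendstoLocallyUniformly (fun k => w (φ k) t) (W t) Filter.atTop) := by
  -- adapted from Literature/Analysis/FluidPDE/KNSSTypeIRateMildCompactnessProofs.lean
  -- (`KNSS2009_typeI_rate_mildCompactness_holds`, verbatim minus the unused hypotheses)
  intro C A B w q hC hAlim hBpos hw hmildAB hI
  -- ## Step 1: per-`k` facts
  have hcont : ∀ k, ContinuousOn (uncurry (w k)) (Ioo (A k) (B k) ×ˢ univ) := fun k =>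
    (hw k).smooth_velocity.continuousOn
  have hslice : ∀ k, ∀ t ∈ Ioo (A k) (B k), Continuous (w k t) := fun k t ht =>
    (hcont k).comp_continuous (Continuous.prodMk_right t) fun x => ⟨ht, mem_univ x⟩
  have hbdd : ∀ k, ∀ τ ∈ Ioo (A k) 0, ∀ x, ‖w k τ x‖ ≤ C / Real.sqrt (-τ) := by
    intro k τ hτ x
    have hs : 0 < Real.sqrt (-τ) := Real.sqrt_pos.2 (neg_pos.2 hτ.2)
    rw [le_div_iff₀ hs, mul_comm]
    exact hI k τ hτ x
  -- elementary: `C/√(−τ) ≤ C/√δ` for `τ ≤ −δ < 0`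
  have div_sqrt_neg_le : ∀ {δ τ : ℝ}, 0 ≤ C → 0 < δ → τ ≤ -δ →
      C / Real.sqrt (-τ) ≤ C / Real.sqrt δ := fun hC' hδ hτ =>
    div_le_div_of_nonneg_left hC' (Real.sqrt_pos.2 hδ) (Real.sqrt_le_sqrt (by linarith))
  -- the Oseen identity between negative times is part of the data (`t < 0 < B k`)
  have hmild : ∀ k, ∀ s t : ℝ, A k < s → s < t → t < 0 → ∀ x,
      w k t x = UnboundedOperators.heatExtension (w k s) (t - s) x -
        oseenDuhamel 1 s (w k) (w k) t x :=
    fun k s t hAs hst ht0 x => hmildAB k s t hAs hst (ht0.trans (hBpos k)) x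
  -- ## Step 2: the uniform Hölder modulus on the slab pieces
  obtain ⟨K₀, hK₀, hHold⟩ := exists_holder_quarter_of_oseenMild (E := (EuclideanSpace ℝ (Fin 3)))
  -- bound and modulus constant on the `n`-th piece
  set R : ℕ → ℝ := fun n => C / Real.sqrt (1 / ((n : ℝ) + 2)) with hR
  have hR0 : ∀ n, 0 ≤ R n := fun n => by rw [hR]; positivity
  set V : ℕ → ℝ × (EuclideanSpace ℝ (Fin 3)) → (EuclideanSpace ℝ (Fin 3)) :=
    fun k z => w k z.1 z.2 with hV
  -- the slab pieces `[−(n+2), −1/(n+2)] × B̄(0, n+2)` of `HolderExtraction.lean`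
  set T : ℕ → Set (ℝ × (EuclideanSpace ℝ (Fin 3))) := fun n =>
    Icc (-((n : ℝ) + 2)) (-(1 / ((n : ℝ) + 2))) ×ˢ
      closedBall (0 : (EuclideanSpace ℝ (Fin 3))) ((n : ℝ) + 2) with hT
  have hVn : ∀ n : ℕ, ∀ᶠ k in atTop, ContinuousOn (V k) (T n) ∧
      (∀ z ∈ T n, ‖V k z‖ ≤ R n) ∧
      ∀ z ∈ T n, ∀ z' ∈ T n,
        dist (V k z) (V k z') ≤ K₀ * (R n + R n ^ 2) * dist z z' ^ (1 / 4 : ℝ) := by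
    intro n
    have hn2 : (0 : ℝ) < (n : ℝ) + 2 := by positivity
    have hδ : (0 : ℝ) < 1 / ((n : ℝ) + 2) := by positivity
    filter_upwards [hAlim.eventually (eventually_lt_atBot (-((n : ℝ) + 3)))] with k hk
    -- the window `[a, b] = [−(n+3), −1/(n+2)] ⊂ (A k, 0)`
    set a : ℝ := -((n : ℝ) + 3) with ha
    set b : ℝ := -(1 / ((n : ℝ) + 2)) with hb
    have hb0 : b < 0 := by rw [hb]; linarith
    have hIcc : ∀ t ∈ Icc a b, t ∈ Ioo (A k) (B k) := fun t ht =>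
      ⟨hk.trans_le ht.1, (ht.2.trans_lt hb0).trans (hBpos k)⟩
    have hIcc0 : ∀ t ∈ Icc a b, t ∈ Ioo (A k) 0 := fun t ht =>
      ⟨hk.trans_le ht.1, ht.2.trans_lt hb0⟩
    have hbR : ∀ t ∈ Icc a b, ∀ x, ‖w k t x‖ ≤ R n := fun t ht x =>
      (hbdd k t (hIcc0 t ht) x).trans (div_sqrt_neg_le hC.le hδ (by rw [hb] at ht; exact ht.2))
    have hmod := hHold (hR0 n) (fun t ht => hslice k t (hIcc t ht)) hbR
      (fun s t has hst htb x => hmild k s t (hk.trans_le has) hst (htb.trans_lt hb0) x)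
    have hpiece : ∀ z ∈ T n, z.1 ∈ Icc (a + 1) b := fun z hz => by
      obtain ⟨⟨h1, h2⟩, -⟩ := mem_slabPiece.1 hz
      exact ⟨by rw [ha]; linarith, by rw [hb]; exact h2⟩
    refine ⟨?_, fun z hz => ?_, fun z hz z' hz' => ?_⟩
    · refine (hcont k).mono fun z hz => ⟨?_, mem_univ _⟩
      have h := hpiece z hz
      exact hIcc z.1 ⟨by linarith [h.1], h.2⟩
    · have h := hpiece z hz
      exact hbR z.1 ⟨by linarith [h.1], h.2⟩ z.2
    · have h := hmod z'.1 (hpiece z' hz') z.1 (hpiece z hz) z'.2 z.2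
      rw [dist_eq_norm, Prod.dist_eq, Real.dist_eq, dist_eq_norm]
      exact h
  -- ## Step 3: extraction
  obtain ⟨φ, hφ, W₀, hW₀⟩ := exists_strictMono_tendstoUniformlyOn_of_bound
    (fun n => isCompact_slabPiece (E := (EuclideanSpace ℝ (Fin 3))) n) (fun n => by positivity)
    (fun _ => by norm_num) hVn
  have hφt : Tendsto φ atTop atTop := hφ.tendsto_atTop
  have hθA : Tendsto (fun j => A (φ j)) atTop atBot := hAlim.comp hφt
  set W : ℝ → (EuclideanSpace ℝ (Fin 3)) → (EuclideanSpace ℝ (Fin 3)) := fun t x => W₀ (t, x)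
    with hWdef
  have hVφ : ∀ n, ∀ᶠ j in atTop, ContinuousOn (V (φ j)) (T n) := fun n =>
    (hφt.eventually (hVn n)).mono fun j hj => hj.1
  -- continuity of the limit on the open slab
  have hWc : ContinuousOn (uncurry W) (Iio 0 ×ˢ univ) := by
    have h := continuousOn_slab_of_tendstoUniformlyOn hVφ hW₀
    exact h.congr fun z _ => rfl
  -- pointwise convergence at negative times
  have hpt : ∀ t < 0, ∀ x, Tendsto (fun j => w (φ j) t x) atTop (𝓝 (W t x)) := fun t ht x =>
    tendsto_of_tendstoUniformlyOn_slabPiece hW₀ ht x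
  -- eventually the slice lies in the domain
  have hdom : ∀ t : ℝ, ∀ᶠ j in atTop, A (φ j) < t := fun t =>
    hθA.eventually (eventually_lt_atBot t)
  refine ⟨φ, W, hφ, hWc, fun t ht => ?_, fun t ht x => ?_, fun s t hst ht x => ?_, fun t ht => ?_⟩
  · -- ## Step 4a: weak divergence-freeness of the limit slices
    intro θ hθ
    have hθ1 : ContDiff ℝ 1 θ := contDiff_infty.1 hθ.contDiff 1
    have hgc : HasCompactSupport (gradient θ) := by
      have : gradient θ =
          (fun L => (InnerProductSpace.toDual ℝ (EuclideanSpace ℝ (Fin 3))).symm L) ∘ fderiv ℝ θ :=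
        rfl
      rw [this]
      exact (hθ.hasCompactSupport.fderiv (𝕜 := ℝ)).comp_left (by simp)
    set Mt : ℝ := C / Real.sqrt (-t) with hMt
    have hθi : Integrable (fun x => Mt * ‖gradient θ x‖) volume :=
      (((continuous_gradient_of_contDiff hθ1).integrable_of_hasCompactSupport hgc).norm).const_mul Mt
    have hlimθ : Tendsto (fun j => ∫ x, ⟪w (φ j) t x, gradient θ x⟫) atTop
        (𝓝 (∫ x, ⟪W t x, gradient θ x⟫)) := by
      refine tendsto_integral_filter_of_dominated_convergence (fun x => Mt * ‖gradient θ x‖)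
        ?_ ?_ hθi (Eventually.of_forall fun x => (hpt t ht x).inner tendsto_const_nhds)
      · filter_upwards [hdom t] with j hj
        exact ((hslice (φ j) t ⟨hj, ht.trans (hBpos _)⟩).inner
          (continuous_gradient_of_contDiff hθ1)).aestronglyMeasurable
      · filter_upwards [hdom t] with j hj
        exact Eventually.of_forall fun x => (norm_inner_le_norm _ _).trans
          (mul_le_mul_of_nonneg_right (hbdd (φ j) t ⟨hj, ht⟩ x) (norm_nonneg _))
    have hzero : ∀ᶠ j in atTop, ∫ x, ⟪w (φ j) t x, gradient θ x⟫ = 0 := by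
      filter_upwards [hdom t] with j hj
      have htj : t ∈ Ioo (A (φ j)) (B (φ j)) := ⟨hj, ht.trans (hBpos _)⟩
      exact VectorCalculus.IsDivFree.isWeaklyDivFree_holds ((hw (φ j)).divFree t htj)
        (contDiff_infty.1 ((hw (φ j)).contDiff_velocity htj) 1) θ hθ
    exact tendsto_nhds_unique hlimθ (tendsto_const_nhds.congr' (hzero.mono fun j hj => hj.symm))
  · -- ## Step 4b: the bound `√(−t)‖W‖ ≤ C`
    refine le_of_tendsto ((hpt t ht x).norm.const_mul (Real.sqrt (-t))) ?_
    filter_upwards [hdom t] with j hj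
    exact hI (φ j) t ⟨hj, ht⟩ x
  · -- ## Step 5: the Oseen identity in the limit
    have hs0 : s < 0 := hst.trans ht
    obtain ⟨k₀, hk₀⟩ := eventually_atTop.1 (hdom s)
    set u : ℕ → ℝ → (EuclideanSpace ℝ (Fin 3)) → (EuclideanSpace ℝ (Fin 3)) :=
      fun j => w (φ (j + k₀)) with hu
    have hAu : ∀ j, A (φ (j + k₀)) < s := fun j => hk₀ _ (Nat.le_add_left _ _)
    have hshift : Tendsto (fun j => j + k₀) atTop atTop := tendsto_add_atTop_nat k₀
    -- bound on `(s, t)`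
    set M₀ : ℝ := C / Real.sqrt (-t) with hM₀
    have hM₀0 : 0 ≤ M₀ := by rw [hM₀]; have := hC.le; positivity
    have huM : ∀ j, ∀ τ ∈ Ioo s t, ∀ y, ‖u j τ y‖ ≤ M₀ := fun j τ hτ y =>
      (hbdd _ τ ⟨(hAu j).trans hτ.1, hτ.2.trans ht⟩ y).trans
        (div_sqrt_neg_le hC.le (neg_pos.2 ht) (by linarith [hτ.2]))
    -- measurability
    have hum : ∀ j, AEStronglyMeasurable (uncurry (u j))
        ((volume : Measure (ℝ × (EuclideanSpace ℝ (Fin 3)))).restrict (Ioo s t ×ˢ univ)) :=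
      fun j => ((hcont _).mono (prod_mono
        (fun τ hτ => ⟨(hAu j).trans hτ.1, (hτ.2.trans ht).trans (hBpos _)⟩)
          Subset.rfl)).aestronglyMeasurable (measurableSet_Ioo.prod MeasurableSet.univ)
    have hWm : AEStronglyMeasurable (uncurry W)
        ((volume : Measure (ℝ × (EuclideanSpace ℝ (Fin 3)))).restrict (Ioo s t ×ˢ univ)) :=
      (hWc.mono (prod_mono (fun τ hτ => hτ.2.trans ht) Subset.rfl)).aestronglyMeasurable
        (measurableSet_Ioo.prod MeasurableSet.univ)
    -- pointwise convergence along the shifted subsequence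
    have hptu : ∀ τ < 0, ∀ y, Tendsto (fun j => u j τ y) atTop (𝓝 (W τ y)) := fun τ hτ y =>
      (hpt τ hτ y).comp hshift
    -- the Duhamel term
    have hD : Tendsto (fun j => oseenDuhamel 1 s (u j) (u j) t x) atTop
        (𝓝 (oseenDuhamel 1 s W W t x)) :=
      tendsto_oseenDuhamel_of_tendsto_of_bound one_pos hM₀0 hst hum hWm huM
        (fun τ hτ y => hptu τ (hτ.2.trans ht) y) x
    -- the caloric term
    have hH : Tendsto (fun j => UnboundedOperators.heatExtension (u j s) (t - s) x) atTop
        (𝓝 (UnboundedOperators.heatExtension (W s) (t - s) x)) := by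
      refine tendsto_heatExtension_of_tendsto_of_bound (M := C / Real.sqrt (-s))
        (fun j => (hslice _ s ⟨hAu j, hs0.trans (hBpos _)⟩).aestronglyMeasurable)
        (fun j z => hbdd _ s ⟨hAu j, hs0⟩ z) (hptu s hs0) (sub_pos.2 hst) x
    -- the identity for each `j` and the limit
    have hid : (fun j => u j t x) = fun j =>
        UnboundedOperators.heatExtension (u j s) (t - s) x - oseenDuhamel 1 s (u j) (u j) t x :=
      funext fun j => hmild _ s t (hAu j) hst ht x
    have hlim2 : Tendsto (fun j => u j t x) atTop
        (𝓝 (UnboundedOperators.heatExtension (W s) (t - s) x - oseenDuhamel 1 s W W t x)) := by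
      rw [hid]; exact hH.sub hD
    exact tendsto_nhds_unique (hptu t ht x) hlim2
  · -- ## Step 3': slice-wise locally uniform convergence
    exact tendstoLocallyUniformly_slice_of_tendstoUniformlyOn_slabPiece hW₀ ht

end Summit.NavierStokesRegularity.NavierStokesRegularity.Theorems

end
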